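import Literature.Computability.Complexity.StackNumeric
import Literature.Computability.Complexity.StackItemOps
import HarnessLib

/-!
# Summing a list of numerals: item lists meet the numeric procedure layer

Trunk complexity toolkit; a worked client of `StackItemOps.lean` (`popInto`, lists of items
under arbitrary register names) together with `StackNumeric.lean` (the calculator convention
`base T` over `EReg ⊕ β`, `nAdd`, the counted loop `runs_loop_count`).  It is the template for
"numeric stack programs": a counted loop whose body pops one item of a list register into a
scalar register, applies bank arithmetic, and clears the scratch — with a step bound LINEAR in
the number of items times a polynomial in the numeral length:

* `Com.SumRegs β` — the six register names (accumulator, list, payload, sign, token, counter)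
  with their distinctness;
* `Com.sumStep`, `Com.sumList` — `acc := acc + (pop k)` repeated `|cnt|` times;
* `Com.sumState` — the register file after `j` rounds; **`runs_sumList`**: from
  `k = numItems vs ++ rest`, `acc = encodeNat A₀` the loop ends with `k = rest… (items consumed)`,
  `acc = encodeNat (A₀ + ∑ vs)` within `|vs| · (75n + 78) + 1` steps, `n` bounding the lengths
  of the item numerals and of the partial sums.

## References

* T. Nipkow, G. Klein, *Concrete Semantics with Isabelle/HOL*, Springer 2014, §7.2.
* D. E. Knuth, *The Art of Computer Programming*, Vol. 2, 3rd ed., 1998, §4.3.1 (the addition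
  iterated here). (Folklore material, fully proved here.)
-/

namespace Literature.Computability.Complexity

open _root_.Computability

namespace Com

variable {β : Type} [DecidableEq β]

/-- The register names of the list-summing loop, pairwise distinct: accumulator `acc`, list
`k`, payload scratch `x`, sign scratch `s`, token scratch `w`, loop counter `cnt`. [folklore] -/
structure SumRegs (β : Type) where
  /-- accumulator -/ acc : β
  /-- the list register -/ k : β
  /-- payload scratch -/ x : β
  /-- sign scratch -/ s : β
  /-- token scratch -/ w : β
  /-- loop counter -/ cnt : β
  /-- `acc ≠ k` -/ hak : acc ≠ k
  /-- `acc ≠ x` -/ hax : acc ≠ x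
  /-- `acc ≠ s` -/ has : acc ≠ s
  /-- `acc ≠ w` -/ haw : acc ≠ w
  /-- `acc ≠ cnt` -/ hac : acc ≠ cnt
  /-- `k ≠ x` -/ hkx : k ≠ x
  /-- `k ≠ s` -/ hks : k ≠ s
  /-- `k ≠ w` -/ hkw : k ≠ w
  /-- `k ≠ cnt` -/ hkc : k ≠ cnt
  /-- `x ≠ s` -/ hxs : x ≠ s
  /-- `x ≠ w` -/ hxw : x ≠ w
  /-- `x ≠ cnt` -/ hxc : x ≠ cnt
  /-- `s ≠ w` -/ hsw : s ≠ w
  /-- `s ≠ cnt` -/ hsc : s ≠ cnt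
  /-- `w ≠ cnt` -/ hwc : w ≠ cnt

/-- One round: pop the first item of `k` into `x`, `acc := acc + x`, clear `x`. [folklore] -/
def sumStep (r : SumRegs β) : Com (EReg ⊕ β) :=
  (popInto r.k r.x r.s r.w).map Sum.inr ;; nAdd r.acc r.acc r.x ;; (clear r.x).map Sum.inr

/-- `sumList`: one round per bit of the counter `cnt`. [folklore] -/
def sumList (r : SumRegs β) : Com (EReg ⊕ β) :=
  loop (Sum.inr r.cnt) (sumStep r) (sumStep r)

/-- The coded list of the numerals of `vs` (items with sign `false`). [folklore] -/
def numItems (vs : List ℕ) : List Bool := encItems (vs.map fun v => (encodeNat v, false))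

/-- `numItems` of a cons. [folklore] -/
@[simp] theorem numItems_cons (v : ℕ) (vs : List ℕ) :
    numItems (v :: vs) = encItem (encodeNat v) false ++ numItems vs := by
  simp [numItems]

/-- The outer register file after `j` rounds: `j` items consumed, their sum added to the
accumulator. [folklore] -/
def sumState (r : SumRegs β) (T : Regs β) (A₀ : ℕ) (vs : List ℕ) (rest : List Bool) (j : ℕ) :
    Regs β :=
  Function.update (Function.update T r.k (numItems (vs.drop j) ++ rest)) r.acc
    (encodeNat (A₀ + (vs.take j).sum))

/-- **Simulation of `sumList`**: with the scratch registers `x, s, w` empty, the list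
`numItems vs ++ rest` in `k`, `encodeNat A₀` in `acc` and a counter of length `|vs|` in `cnt`,
the loop consumes the items and leaves `encodeNat (A₀ + ∑ vs)` in `acc`, within
`|vs| · (75n + 78) + 1` steps, provided every item numeral and every partial sum has length
`≤ n`. [folklore] -/
theorem runs_sumList (r : SumRegs β) (T : Regs β) (A₀ n : ℕ) (vs : List ℕ) (rest : List Bool)
    (hx : T r.x = []) (hs : T r.s = []) (hw : T r.w = []) (hc : T r.cnt = [])
    (hV : ∀ v ∈ vs, (encodeNat v).length ≤ n)
    (hA : ∀ j ≤ vs.length, (encodeNat (A₀ + (vs.take j).sum)).length ≤ n)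
    (cw : List Bool) (hcw : cw.length = vs.length) :
    Runs (sumList r) (base (Function.update (sumState r T A₀ vs rest 0) r.cnt cw))
      (base (sumState r T A₀ vs rest vs.length)) (vs.length * (75 * n + 78) + 1) := by
  have hak := r.hak; have hax := r.hax; have has := r.has; have haw := r.haw; have hac := r.hac
  have hkx := r.hkx; have hks := r.hks; have hkw := r.hkw; have hkc := r.hkc; have hxs := r.hxs
  have hxw := r.hxw; have hxc := r.hxc; have hsw := r.hsw; have hsc := r.hsc; have hwc := r.hwc
  -- reading the state function
  have rd : ∀ (j : ℕ) (q : β), sumState r T A₀ vs rest j q =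
      if q = r.acc then encodeNat (A₀ + (vs.take j).sum)
      else if q = r.k then numItems (vs.drop j) ++ rest else T q := by
    intro j q; simp only [sumState, Function.update_apply]
  have hC : ∀ j, base (sumState r T A₀ vs rest j) (Sum.inr r.cnt) = [] := by
    intro j
    simp only [nst_inr]
    rw [rd, if_neg hac.symm, if_neg hkc.symm, hc]
  -- one round
  have hbody : ∀ j (w' : List Bool), j < vs.length →
      Runs (sumStep r) (Function.update (base (sumState r T A₀ vs rest j)) (Sum.inr r.cnt) w')
        (Function.update (base (sumState r T A₀ vs rest (j + 1))) (Sum.inr r.cnt) w')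
        (75 * n + 76) := by
    intro j w' hj
    set U : Regs β := Function.update (sumState r T A₀ vs rest j) r.cnt w' with hU
    have rU : ∀ q, U q = if q = r.cnt then w' else if q = r.acc then encodeNat (A₀ + (vs.take j).sum)
        else if q = r.k then numItems (vs.drop j) ++ rest else T q := by
      intro q; rw [hU, Function.update_apply, rd]
    have hdrop : vs.drop j = vs[j] :: vs.drop (j + 1) := List.drop_eq_getElem_cons hj
    have hUk : U r.k = encItem (encodeNat vs[j]) false ++ (numItems (vs.drop (j + 1)) ++ rest) := by
      rw [rU, if_neg hkc, if_neg hak.symm, if_pos rfl, hdrop, numItems_cons, List.append_assoc]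
    have hUx : U r.x = [] := by rw [rU, if_neg hxc, if_neg hax.symm, if_neg hkx.symm, hx]
    have hUs : U r.s = [] := by rw [rU, if_neg hsc, if_neg has.symm, if_neg hks.symm, hs]
    have hUw : U r.w = [] := by rw [rU, if_neg hwc, if_neg haw.symm, if_neg hkw.symm, hw]
    -- (1) pop
    have h1 := Runs.inr (runs_popInto hkx hks hkw hxs hxw hsw U hUk hUx hUs hUw)
      (Sum.elim (Sum.elim aClean mClean) eClean : Regs EReg)
    set U1 : Regs β := Function.update (Function.update (Function.update (Function.update U r.k
      (numItems (vs.drop (j + 1)) ++ rest)) r.x (encodeNat vs[j])) r.s (flag false)) r.w []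
      with hU1
    have rU1 : ∀ q, U1 q = if q = r.w then [] else if q = r.s then flag false
        else if q = r.x then encodeNat vs[j]
        else if q = r.k then numItems (vs.drop (j + 1)) ++ rest else U q := by
      intro q; simp only [hU1, Function.update_apply]
    have hU1acc : U1 r.acc = encodeNat (A₀ + (vs.take j).sum) := by
      rw [rU1, if_neg haw, if_neg has, if_neg hax, if_neg hak, rU, if_neg hac, if_pos rfl]
    have hU1x : U1 r.x = encodeNat vs[j] := by rw [rU1, if_neg hxw, if_neg hxs, if_pos rfl]
    have hvj : (encodeNat vs[j]).length ≤ n := hV _ (List.getElem_mem hj)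
    have hAj : (encodeNat (A₀ + (vs.take j).sum)).length ≤ n := hA j hj.le
    -- (2) add
    have h2 := runs_nAdd r.acc r.acc r.x U1 (n := n) (by rw [hU1acc]; exact hAj)
      (by rw [hU1x]; exact hvj) (by rw [hU1acc]; omega)
    rw [hU1acc, hU1x, bitsToNat_encodeNat, bitsToNat_encodeNat] at h2
    set U2 : Regs β := Function.update U1 r.acc (encodeNat (A₀ + (vs.take j).sum + vs[j])) with hU2
    -- (3) clear
    have h3 := Runs.inr (runs_clear r.x U2) (Sum.elim (Sum.elim aClean mClean) eClean : Regs EReg)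
    have hU2x : U2 r.x = encodeNat vs[j] := by
      rw [hU2, Function.update_of_ne hax.symm, hU1x]
    rw [hU2x] at h3
    -- the final file is the next state
    have hsum : A₀ + (vs.take j).sum + vs[j] = A₀ + (vs.take (j + 1)).sum := by
      rw [List.sum_take_succ _ _ hj]; ring
    have hfile : Function.update U2 r.x [] =
        Function.update (sumState r T A₀ vs rest (j + 1)) r.cnt w' := by
      funext q
      simp only [hU2, Function.update_apply, rU1, rU, rd, hsum]
      by_cases hqx : q = r.x
      · subst hqx; rw [if_pos rfl, if_neg hxc, if_neg hax.symm, if_neg hkx.symm, hx]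
      rw [if_neg hqx]
      by_cases hqa : q = r.acc
      · subst hqa; rw [if_pos rfl, if_neg hac, if_pos rfl]
      rw [if_neg hqa]
      by_cases hqw : q = r.w
      · subst hqw; rw [if_pos rfl, if_neg hwc, if_neg hqa, if_neg hkw.symm, hw]
      rw [if_neg hqw]
      by_cases hqs : q = r.s
      · subst hqs; rw [if_pos rfl, if_neg hsc, if_neg hqa, if_neg hks.symm, hs]; rfl
      rw [if_neg hqs, if_neg hqx]
      by_cases hqk : q = r.k
      · subst hqk; rw [if_pos rfl, if_neg hkc, if_neg hqa, if_pos rfl]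
      rw [if_neg hqk]
      by_cases hqc : q = r.cnt
      · subst hqc; rw [if_pos rfl, if_pos rfl]
      rw [if_neg hqc, if_neg hqa, if_neg hqk, if_neg hqc, if_neg hqa, if_neg hqk]
    have hstart : Function.update (base (sumState r T A₀ vs rest j)) (Sum.inr r.cnt) w' =
        nst aClean mClean eClean U := by
      rw [hU]; simp only [update_nst_inr]
    rw [hstart]
    refine ((h1.seq (h2.seq h3)).of_eq ?_ ?_)
    · rw [hfile]; simp only [update_nst_inr]; rfl
    · omega
  -- the loop
  have hmain := runs_loop_count (C := Sum.inr r.cnt) (fun j => base (sumState r T A₀ vs rest j))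
    (75 * n + 76) vs.length hC hbody cw 0 (by omega)
  simp only [update_nst_inr] at hmain
  refine hmain.of_eq (by rw [Nat.zero_add, hcw]) ?_
  rw [hcw]

end Com

end Literature.Computability.Complexity
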